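import Mathlib
import HarnessLib

/-!
# A finite-order automorphism acting trivially on the graded pieces of a finite filtration is the identity
# (WEIL-2 gen 32, FERMAT-G32 LEMMA AJ2 (iv) — the Leray step of THEOREM F_q; fact-free linear algebra)

research route, not a corollary; conditional on HC_CM plus one named minimal statement.

Cell `pub-hodge-ring2-ab-*` (ALL ABELIAN VARIETIES), seat WEIL-2 gen 32, account
`run/shared/lean/pub/pub-hodge-ring2/pub-hodge-ring2-ab-weil-2/FERMAT-G32.md` §2.2 (LEMMA AJ2 (iv)).

Informal setting (not formalised).  In THEOREM F_q the cyclic group `μ_m` acts on `W₀° = W₀ ∖ F₀` over the base `Pic° = Pic^h X ∖ {D₀}`,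
trivially on the sheaves `R^k f_* ℚ` (it sits in a connected torus acting on the fibres); the Leray spectral sequence then shows that a
generator `ζ` acts on `H^n(W₀°, ℚ)` preserving the finite Leray filtration and trivially on its graded pieces.  The two lemmas below are
the linear algebra that concludes «hence `ζ` acts trivially on `H^n(W₀°, ℚ)`»: (1) an endomorphism preserving a finite chain of submodules
`⊥ = F 0 ≤ F 1 ≤ ⋯ ≤ F k = ⊤` and inducing the identity on each `F (i+1) / F i` has `(g - 1)^k = 0`; (2) over a field of characteristic
zero, an endomorphism of a vector space (no finiteness needed) with `g^m = 1` (`m ≠ 0`) and `g - 1` nilpotent IS the identity (its minimal polynomial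
divides the separable `X^m - 1` and a power of `X - 1`, hence divides `X - 1`); (3) the combination.
0 sorry, no `def`, no named fact, `import Mathlib` only; `HC_CM` does not occur.
-/

namespace Summit.HodgeConjecture.Ring2AbelianAll.FermatAbelJacobiUnipotent

open Polynomial

section Filtration

variable {R M : Type*} [Ring R] [AddCommGroup M] [Module R M]

/-- **Unipotence from a filtration.**  If `g` maps `F (i+1)` into itself up to `F i` — precisely `g v - v ∈ F i` for `v ∈ F (i+1)` —
along a chain of submodules with `F 0 = ⊥` and `F k = ⊤`, then `(g - 1)^k = 0`.  (The Leray filtration of `H^n(W₀°, ℚ)` in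
FERMAT-G32 LEMMA AJ2 (iv): `μ_m` acts trivially on `E_∞^{p, n-p}`.)  [folklore]
research route, not a corollary; conditional on HC_CM plus one named minimal statement. -/
theorem pow_sub_one_eq_zero_of_filtration (g : Module.End R M) (F : ℕ → Submodule R M) {k : ℕ}
    (h0 : F 0 = ⊥) (hk : F k = ⊤) (hF : ∀ i, ∀ v ∈ F (i + 1), g v - v ∈ F i) : (g - 1) ^ k = 0 := by
  -- `(g - 1)^j` maps `F (i + j)` into `F i`
  have key : ∀ j i, ∀ v ∈ F (i + j), ((g - 1) ^ j) v ∈ F i := by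
    intro j
    induction j with
    | zero => intro i v hv; simpa using hv
    | succ j ih =>
      intro i v hv
      have hv' : (g - 1) v ∈ F (i + j) := by
        have := hF (i + j) v (by simpa [Nat.add_assoc] using hv)
        simpa [LinearMap.sub_apply] using this
      have := ih i ((g - 1) v) hv'
      simpa [pow_succ, Module.End.mul_apply] using this
  ext v
  have hv : v ∈ F (0 + k) := by simp [hk]
  have := key k 0 v hv
  rw [h0, Submodule.mem_bot] at this
  simpa using this

end Filtration

section CharZero

variable {K V : Type*} [Field K] [CharZero K] [AddCommGroup V] [Module K V]

/-- **Finite order + unipotent ⟹ identity** (characteristic zero).  If `g^m = 1` with `m ≠ 0` and `g - 1` is nilpotent, then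
`g = 1`: the minimal polynomial of `g` divides `X^m - 1`, which is separable in characteristic zero, so it is squarefree; it also
divides `(X - 1)^(k+1)`, hence (squarefree) divides `X - 1`.  [folklore]
research route, not a corollary; conditional on HC_CM plus one named minimal statement. -/
theorem eq_one_of_pow_eq_one_of_isNilpotent_sub_one (g : Module.End K V) {m : ℕ} (hm : m ≠ 0) (hg : g ^ m = 1)
    (hN : IsNilpotent (g - 1)) : g = 1 := by
  obtain ⟨k, hk⟩ := hN
  have hk' : (g - 1) ^ (k + 1) = 0 := by rw [pow_succ, hk, zero_mul]
  have hdvd₁ : minpoly K g ∣ X ^ m - C (1 : K) := minpoly.dvd K g (by simp [hg])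
  have hdvd₂ : minpoly K g ∣ (X - C (1 : K)) ^ (k + 1) := minpoly.dvd K g (by simp [hk'])
  have hsep : (X ^ m - C (1 : K)).Separable :=
    separable_X_pow_sub_C (1 : K) (Nat.cast_ne_zero.mpr hm) one_ne_zero
  have hsq : Squarefree (minpoly K g) := (hsep.of_dvd hdvd₁).squarefree
  have hdvd₃ : minpoly K g ∣ X - C (1 : K) := (hsq.dvd_pow_iff_dvd (Nat.succ_ne_zero k)).mp hdvd₂
  have h0 : aeval g (X - C (1 : K)) = 0 := by
    obtain ⟨r, hr⟩ := hdvd₃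
    rw [hr, map_mul, minpoly.aeval, zero_mul]
  have h1 : g - 1 = 0 := by simpa using h0
  exact sub_eq_zero.mp h1

/-- **LEMMA AJ2 (iv) of FERMAT-G32, linear-algebra core.**  An endomorphism of finite order of a vector space over a field of
characteristic zero which preserves a finite filtration `⊥ = F 0 ≤ ⋯ ≤ F k = ⊤` up to lower terms (`g v - v ∈ F i` for
`v ∈ F (i+1)`, i.e. it acts trivially on every graded piece) is the identity.  [folklore]
research route, not a corollary; conditional on HC_CM plus one named minimal statement. -/
theorem eq_one_of_pow_eq_one_of_filtration (g : Module.End K V) {m : ℕ} (hm : m ≠ 0) (hg : g ^ m = 1)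
    (F : ℕ → Submodule K V) {k : ℕ} (h0 : F 0 = ⊥) (hk : F k = ⊤)
    (hF : ∀ i, ∀ v ∈ F (i + 1), g v - v ∈ F i) : g = 1 :=
  eq_one_of_pow_eq_one_of_isNilpotent_sub_one g hm hg ⟨k, pow_sub_one_eq_zero_of_filtration g F h0 hk hF⟩

end CharZero

end Summit.HodgeConjecture.Ring2AbelianAll.FermatAbelJacobiUnipotent
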